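import Summits.QuantumFields.BalabanUV.T4Continuum.Support.InsertionChannelFamilyComplex
import Summits.QuantumFields.BalabanUV.T4Continuum.Support.InsertionChannelFamilyLinearBinders

/-!
# InsertionChannelFamilyComplexLinear — the channel road carried to Road D, part 6: the LINEAR-EXTENSION twin of part 5's row-blind
# complex channel insertion on the two-row chart of record (R49 (4)) — the EXACT structural binders `InsAffine ∕ InsHomog ∕ InsBlind`,
# MI-3a with gain `√2·c`, the owner's Re∕Im END with `hdamp` discharged, and the E1′ face on the ROTATED family model
# (cell `pub-balaban`, T⁴ fan-out; row NE5, node U3; `HOME/t4/formal/NE5/LEAVES.md` row O1-c follower; parts 1–5 = p228265 ∕ p228521 ∕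
# p229012 ∕ p229246 ∕ part 5 `InsertionChannelFamilyComplex`; INTENT `HOME/CLAIMS.log` l.18625)

Unit `b2b-balaban-t4-ne5-formalise-leaf-06` (NE5 formalisation swarm, leaf prover 06, gen 13).  Summits-side NEW WORK under the LEAN
PLACEMENT RULE (cell modelling + bookkeeping over ABSTRACT carriers; nothing of the manuscripts under audit is asserted; 0 cite tags; no
`Prop`-valued fact minted — the one `def` is DATA).  HONEST FRAMING: rung (B)+1 of the FINITE-VOLUME T⁴ continuum programme — NOT
infinite volume, NOT a mass gap, NOT the Clay problem, NOT a proof of NE5 (`T4OutputRate.NE5`, NOT PRINTED; cell GAPS G-t4-U3-1) nor of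
NE9; spine 0/9 unchanged; 0/12 leaves instantiated on Bałaban's concrete objects (O1 = the substrate cell, owner R34).  HONEST DEPENDENCY
(cell line, verbatim): continuum YM on T⁴ ⇐ BetaPertH ∧ nine spine estimates (0/9 proved); BetaPertH ⇐ (D1) ∧ (D4) ∧ CAP+tail;
G-an2-4 gates asym, D1 and NE2/3/4.

WHY.  Part 5 typed the row-blind complex insertion `insAtOfChannelC` (part 1's by-construction insertion on the DOUBLED chart at the two
rows of a complex point, combined as `h₀ + I • h₁`) and discharged MI-3a (`hdamp`, gain `√2·c∕ω`) for the owner's Re∕Im END.  As on the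
real chart (part 2's kernel witness `toy_not_insAffine`, located design fact D-ne5leaf06g12-1), the by-construction insertion is
junk-valued on chart-unbounded tables, so the kernel's all-tables identities `InsAffine ∕ InsHomog` are NOT available for it; parts 3–4
restored them on the real chart by a (non-constructive, non-canonical) ℝ-linear RETRACTION onto the good tables.  This file does the
same on the two-row chart: the good tables and the retraction are part 3's AT THE DOUBLED CHART (goodness = channel entries level-bounded
uniformly over BOTH rows of every point), and the complex insertion is the `h₀ + I • h₁` combination of part 3's `insLinOfChannel` at
the two rows — a sum of two ℝ-linear maps, hence exactly affine ∕ homogeneous ∕ blind.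

WHAT THIS FILE TYPES ([folklore] bookkeeping; 0 sorry; every NE9 shape enters BY NAME as a displayed hypothesis, none is discharged):
* §1 DATA **`insLinOfChannelC hadd hhom out g k t w := insLinOfChannel … (w.1, 0) + I • insLinOfChannel … (w.1, 1)`** (row-blind);
  `insLinC_eq_insAtC_of_mem` (faithful on the good tables), `read_insLinC_succ` (junk-free complex reading of the GOOD PART),
  `insLinC_affine_pointwise` ∕ `insLinC_homog_pointwise` ∕ `insLinC_eq_of_agree` (exact, from part 4's identities at both rows),
  `norm_insLinC_sub_le` (MI-3a, gain `√2·c`, part 4's `norm_insLin_sub_le` at both rows + part 5's `norm_add_I_smul_le`),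
  `bddAbove_insLinC` ∕ `famOf_insLinC_apply` (bounded over the chart for EVERY table, so `famOf` is verbatim);
  for leaf-02's per-point slots `P : PointwiseSlots C (𝒰 × Fin 2) Op (Hist F)` with `P.insA = insLinOfChannelC hadd hhom out` on `W`:
  **`insAffine_of_insLinC` ∕ `insHomog_of_insLinC` ∕ `insBlind_of_insLinC`** (EXACT, on all tables), `insertionDampedNat_pointwise_of_insLinC`,
  `insertionDamped_pointwise_of_insLinC` (= the owner's `hdamp`, gain `√2·c∕ω`), `insertionDampedNat_of_insLinC` (model level).
* §2 the `Out`-free STRUCTURAL binders of the owner's ROTATED model `toStepModelRot P` ARE those of `P.toStepModel` (`insAffine_rot_iff`,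
  `insBlind_rot_iff`, `insHomog_rot_iff`, `insScaleBound_rot_iff` — `Iff.rfl`, completing the owner's `operatorRate ∕ insertionRate ∕
  insertionDamped ∕ inBase_rot_iff`).
* §3 ENDs: **`ne5_of_pointwiseSlots_reIm_insLinC`** = the owner's `ne5_of_pointwiseSlots_reIm` VERBATIM IN TYPE with `hdamp` REPLACED by `hins` +
  row NE9's displayed letters on the doubled chart; **`ne5_reIm_of_pointwiseSlots_insLinC_fibre_scale_nat`** = E1′
  (`StepModel.ne5_at_of_stepModel_fibre_scale_nat`, the face that CARRIES `InsAffine ∧ InsBlind ∧ InsHomog` + the single-scale term) ON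
  THE ROTATED MODEL over `paramCarriers C (𝒰 × Fin 2)`: the three structural binders EXACT from §1 (through §2), the single-scale term
  from MI-3a by part 4's generic algebra (reference level `E₁ := 1`, idle), representation ∕ admissibility from the COMPLEX identities at
  every point (owner's `representsA∕B_reIm_of_pointwise`), the complex-domain decay bounds (`decayBound_reImTab`), W1 ∕ W4 from their
  per-point forms, the two FIBRE envelopes DISPLAYED at the rotated model; then the owner's `ne5_of_ne5_reImTab` along the real section
  `ι'` ⟹ LITERALLY `T4OutputRate.NE5 EA EB W κ θ′ C₅` over the ORIGINAL carriers with E1′'s constant at the gain `√2·c`.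
HONEST RIDER (as in part 5, asserted by nobody): row NE9's channel binders are READ ON THE DOUBLED COMPLEX CHART (one common profile `τ`
of the REAL two-output channel, `≤ √2×` the complex-modulus profile under per-row majorants — absorbed in the free letter `c`).  NOT IN THIS FILE: no
instance on Bałaban's objects (substrate O-8 ∕ D-8, owner R34); no NE9 binder discharged; no W1 ∕ W2 touched; the retraction is
NON-CONSTRUCTIVE and NOT CANONICAL (retraction-independence on the kernel's tables holds as in part 3: `insLinC_eq_insAtC_of_mem` ∘
`mem_goodTables_of_bound`).  Headline wording: «NE5 channel road carried to Road D's complex chart — structural binders restored by a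
linear extension; junction only»; never «leaf instantiated».  NE5 NOT PROVED; NE9 NOT PROVED; spine 0/9; rung (B)+1 finite T⁴; NOT
infinite volume ∕ mass gap ∕ Clay.  Axioms ⊆ {propext, Classical.choice, Quot.sound}.
-/

noncomputable section

open scoped BigOperators
open Finset Function Metric Set Complex

namespace Summit.QuantumFields.BalabanUV.T4Continuum.InsertionChannelFamily

open Literature.MathematicalPhysics.QuantumFieldTheory.Balaban1983to89
open Literature.MathematicalPhysics.QuantumFieldTheory.Balaban1983to89.T4OutputRate (Carriers Functional NE5)
open Literature.MathematicalPhysics.QuantumFieldTheory.Balaban1983to89.T4InputCauchyRateData (StepModel tableA tableB mul_sum_age_shift)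
open Literature.MathematicalPhysics.QuantumFieldTheory.Balaban1983to89.T4HistoryLipschitzRecursion
  (ChannelAdditive ChannelLocal ChannelStepSum ChannelSizeAtStepNN)
open Summit.QuantumFields.BalabanUV.T4Continuum.B13HistDatum (HistFrame Hist)
open Summit.QuantumFields.BalabanUV.T4Continuum.InsertionChannelReading (ChannelHomog read_sub read_smul eq_of_read_eq)
open Summit.QuantumFields.BalabanUV.T4Continuum.InsertionChannelInstance (tableOf read_tableOf)
open Summit.QuantumFields.BalabanUV.T4Continuum.OutputRateFunctionalTables
open Summit.QuantumFields.BalabanUV.T4Continuum.OutputRateFunctionalTablesFamily (Fam famOf famOf_apply toBgFamily norm_famOf_sub_famOf_le)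
open Summit.QuantumFields.BalabanUV.T4Continuum.OutputRateFunctionalTablesPointwise (PointwiseSlots)
open Summit.QuantumFields.BalabanUV.T4Continuum.OutputRateFunctionalTablesComplex (reImTab decayBound_reImTab ne5_of_ne5_reImTab)
open Summit.QuantumFields.BalabanUV.T4Continuum.OutputRateFunctionalTablesComplexPointwise

variable {C : Carriers} {𝒰 ι : Type} {F : HistFrame C}

/-! ## §1 The row-blind complex linear-extension insertion: exact structural binders on the two-row chart -/

section InsLinC

variable {T : ℕ → (ℕ → ℝ) → (𝒰 × Fin 2 → C.Dom → ℝ) → ι → ℝ}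
variable (hadd : ChannelAdditive (Set.univ : Set (𝒰 × Fin 2 → C.Dom → ℝ)) T)
  (hhom : ChannelHomog (Set.univ : Set (𝒰 × Fin 2 → C.Dom → ℝ)) T) (out : 𝒰 × Fin 2 → F.Idx → ι)

/-- [folklore] DATA: **THE ROW-BLIND COMPLEX LINEAR-EXTENSION INSERTION** — part 3's `insLinOfChannel` (faithful on the good tables of the
DOUBLED chart, ℝ-linear on all tables, never junk) at the two rows of the point, combined as `h₀ + I • h₁`. -/
def insLinOfChannelC (g : ℕ → ℝ) (k : ℕ) (t : C.Dom × (𝒰 × Fin 2) → ℝ) (w : 𝒰 × Fin 2) : Hist F :=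
  insLinOfChannel hadd hhom out g k t (w.1, 0) + I • insLinOfChannel hadd hhom out g k t (w.1, 1)

/-- [folklore] Row-blind. -/
theorem insLinOfChannelC_rowBlind (g : ℕ → ℝ) (k : ℕ) (t : C.Dom × (𝒰 × Fin 2) → ℝ) (u : 𝒰) (i j : Fin 2) :
    insLinOfChannelC hadd hhom out g k t (u, i) = insLinOfChannelC hadd hhom out g k t (u, j) := rfl

/-- [folklore] **FAITHFUL ON THE GOOD TABLES**: for a table good at step `k` (on the doubled chart) the linear-extension insertion IS part 5's. -/
theorem insLinC_eq_insAtC_of_mem {g : ℕ → ℝ} {k : ℕ} {t : C.Dom × (𝒰 × Fin 2) → ℝ}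
    (ht : t ∈ goodTables hadd hhom out k g) (w : 𝒰 × Fin 2) :
    insLinOfChannelC hadd hhom out g (k + 1) t w = insAtOfChannelC T out g (k + 1) t w := by
  rw [insLinOfChannelC, insAtOfChannelC, insLin_eq_insAt_of_mem hadd hhom out ht, insLin_eq_insAt_of_mem hadd hhom out ht]

/-- [folklore] **THE READING, JUNK-FREE FOR EVERY TABLE**: the entry `i` at either row of `u` of the step-`k+1` inserted history is
the complex number assembled from the two channel outputs on the background family of the table's GOOD PART. -/
theorem read_insLinC_succ (g : ℕ → ℝ) (k : ℕ) (t : C.Dom × (𝒰 × Fin 2) → ℝ) (u : 𝒰) (j : Fin 2) (i : F.Idx) :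
    F.read (insLinOfChannelC hadd hhom out g (k + 1) t (u, j)) i =
      ((T k g (toBgFamily (goodPart hadd hhom out k g t)) (out (u, 0) i) : ℝ) : ℂ) +
        I * ((T k g (toBgFamily (goodPart hadd hhom out k g t)) (out (u, 1) i) : ℝ) : ℂ) := by
  rw [insLinOfChannelC, read_add_I_smul, read_insLin_succ, read_insLin_succ]

/-- [folklore] Part 3's insertion has real read-outs. -/
theorem im_read_insLin (g : ℕ → ℝ) (k : ℕ) (t : C.Dom × (𝒰 × Fin 2) → ℝ) (w : 𝒰 × Fin 2) (i : F.Idx) :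
    (F.read (insLinOfChannel hadd hhom out g k t w) i).im = 0 := by
  cases k with
  | zero => rw [insLinOfChannel_zero, read_zero, zero_im]
  | succ k => rw [read_insLin_succ, ofReal_im]

/-- [folklore] **AFFINE AT EVERY POINT, ON ALL TABLES** (exact) — part 4's `insLin_affine_pointwise` at both rows. -/
theorem insLinC_affine_pointwise (g : ℕ → ℝ) (k : ℕ) (t t' : C.Dom × (𝒰 × Fin 2) → ℝ) (w : 𝒰 × Fin 2) :
    insLinOfChannelC hadd hhom out g k t w - insLinOfChannelC hadd hhom out g k t' w =
      insLinOfChannelC hadd hhom out g k (t - t') w - insLinOfChannelC hadd hhom out g k 0 w := by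
  simp only [insLinOfChannelC]
  rw [add_I_smul_sub_add_I_smul, add_I_smul_sub_add_I_smul, insLin_affine_pointwise hadd hhom out g k t t' (w.1, 0),
    insLin_affine_pointwise hadd hhom out g k t t' (w.1, 1)]

/-- [folklore] **HOMOGENEOUS AT EVERY POINT, ON ALL TABLES** (exact) — part 4's `insLin_homog_pointwise` at both rows. -/
theorem insLinC_homog_pointwise (g : ℕ → ℝ) (k : ℕ) (a : ℝ) (t : C.Dom × (𝒰 × Fin 2) → ℝ) (w : 𝒰 × Fin 2) :
    insLinOfChannelC hadd hhom out g k (a • t) w - insLinOfChannelC hadd hhom out g k 0 w =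
      (a : ℂ) • (insLinOfChannelC hadd hhom out g k t w - insLinOfChannelC hadd hhom out g k 0 w) := by
  simp only [insLinOfChannelC]
  rw [add_I_smul_sub_add_I_smul, add_I_smul_sub_add_I_smul, insLin_homog_pointwise hadd hhom out g k a t (w.1, 0),
    insLin_homog_pointwise hadd hhom out g k a t (w.1, 1), smul_add, smul_comm (a : ℂ) I]

/-- [folklore] **BLIND ABOVE THE STEP, ON ALL TABLES** (exact; `ChannelLocal univ T`). -/
theorem insLinC_eq_of_agree (hloc : ChannelLocal (Set.univ : Set (𝒰 × Fin 2 → C.Dom → ℝ)) T) (g : ℕ → ℝ) (k : ℕ)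
    {t t' : C.Dom × (𝒰 × Fin 2) → ℝ} (h : ∀ Y, C.scale Y < k → ∀ w, t (Y, w) = t' (Y, w)) (w : 𝒰 × Fin 2) :
    insLinOfChannelC hadd hhom out g k t w = insLinOfChannelC hadd hhom out g k t' w := by
  rw [insLinOfChannelC, insLinOfChannelC, insLin_eq_of_agree hadd hhom out hloc g k h (w.1, 0),
    insLin_eq_of_agree hadd hhom out hloc g k h (w.1, 1)]

/-- [folklore] **THE PER-POINT MI-3a BOUND FOR THE COMPLEX LINEAR-EXTENSION INSERTION** (gain `√2·c`). -/
theorem norm_insLinC_sub_le {κ c ω : ℝ} {wt : ℕ → ι → ℝ} {τ : ℕ → ℕ → ℝ} {rH : ℕ → ℝ}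
    (hsum : ChannelStepSum (Set.univ : Set (𝒰 × Fin 2 → C.Dom → ℝ)) T)
    (hsize : ChannelSizeAtStepNN (Set.univ : Set (𝒰 × Fin 2 → C.Dom → ℝ)) T κ wt τ) (hwt0 : ∀ k w i, 0 ≤ wt k (out w i))
    (hwt : ∀ k w i, wt k (out w i) ≤ rH (k + 1) * F.wt i) (hτ : ∀ k j, j ≤ k → τ k j ≤ c * ω ^ (k - j)) (hc : 0 ≤ c)
    (hω : 0 ≤ ω) (hrH : ∀ k, 0 ≤ rH k) (k : ℕ) (g : ℕ → ℝ) {t t' : C.Dom × (𝒰 × Fin 2) → ℝ} {D : ℕ → ℝ}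
    (hD : ∀ j < k, 0 ≤ D j)
    (hb : ∀ Y, C.scale Y < k → ∀ w, |t (Y, w) - t' (Y, w)| ≤ D (C.scale Y) * Real.exp (-(κ * C.d Y))) (w : 𝒰 × Fin 2) :
    ‖insLinOfChannelC hadd hhom out g k t w - insLinOfChannelC hadd hhom out g k t' w‖ ≤
      rH k * (Real.sqrt 2 * c * ∑ j ∈ range k, ω ^ (k - 1 - j) * D j) := by
  have hS : 0 ≤ ∑ j ∈ range k, ω ^ (k - 1 - j) * D j :=
    sum_nonneg fun j hj => mul_nonneg (pow_nonneg hω _) (hD j (mem_range.1 hj))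
  have hB : 0 ≤ rH k * (c * ∑ j ∈ range k, ω ^ (k - 1 - j) * D j) := mul_nonneg (hrH k) (mul_nonneg hc hS)
  rw [insLinOfChannelC, insLinOfChannelC, add_I_smul_sub_add_I_smul]
  refine (norm_add_I_smul_le hB (norm_insLin_sub_le hadd hhom out hsum hsize hwt0 hwt hτ hc hω hrH k g hD hb (w.1, 0))
    (norm_insLin_sub_le hadd hhom out hsum hsize hwt0 hwt hτ hc hω hrH k g hD hb (w.1, 1)) (fun i => ?_)
    (fun i => ?_)).trans_eq (by ring)
  · rw [read_sub, sub_im, im_read_insLin, im_read_insLin, sub_zero]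
  · rw [read_sub, sub_im, im_read_insLin, im_read_insLin, sub_zero]

/-- [folklore] **BOUNDED OVER THE CHART FOR EVERY TABLE** (so `famOf` reads the complex linear-extension insertion verbatim). -/
theorem bddAbove_insLinC (g : ℕ → ℝ) (k : ℕ) (t : C.Dom × (𝒰 × Fin 2) → ℝ) :
    BddAbove (Set.range fun w => ‖insLinOfChannelC hadd hhom out g k t w‖) := by
  obtain ⟨M, hM⟩ := bddAbove_insLin hadd hhom out g k t
  refine ⟨M + M, ?_⟩
  rintro _ ⟨w, rfl⟩
  have h0 : ‖insLinOfChannel hadd hhom out g k t (w.1, 0)‖ ≤ M := hM ⟨(w.1, 0), rfl⟩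
  have h1 : ‖insLinOfChannel hadd hhom out g k t (w.1, 1)‖ ≤ M := hM ⟨(w.1, 1), rfl⟩
  calc ‖insLinOfChannelC hadd hhom out g k t w‖
      ≤ ‖insLinOfChannel hadd hhom out g k t (w.1, 0)‖ + ‖I • insLinOfChannel hadd hhom out g k t (w.1, 1)‖ := norm_add_le _ _
    _ ≤ M + M := add_le_add h0 (by rwa [norm_smul, norm_I, one_mul])

/-- [folklore] Hence the family model reads it VERBATIM at every chart point. -/
theorem famOf_insLinC_apply (g : ℕ → ℝ) (k : ℕ) (t : C.Dom × (𝒰 × Fin 2) → ℝ) (w : 𝒰 × Fin 2) :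
    famOf (insLinOfChannelC hadd hhom out g k t) w = insLinOfChannelC hadd hhom out g k t w :=
  famOf_apply (bddAbove_insLinC hadd hhom out g k t) w

variable {Op : Type*} [NormedAddCommGroup Op] [NormedSpace ℂ Op] (P : PointwiseSlots C (𝒰 × Fin 2) Op (Hist F))
  {W : Set (ℕ → ℝ)}

/-- [folklore] **`InsAffine` OF THE FAMILY MODEL ON THE TWO-ROW CHART — EXACT, ON ALL TABLES.** -/
theorem insAffine_of_insLinC
    (hins : ∀ k, ∀ g ∈ W, ∀ (t : C.Dom × (𝒰 × Fin 2) → ℝ) (w : 𝒰 × Fin 2),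
      P.insA g k t w = insLinOfChannelC hadd hhom out g k t w) :
    P.toStepModel.InsAffine W := by
  intro k g hg _ t t'
  have hfun : ∀ s, P.insA g k s = insLinOfChannelC hadd hhom out g k s := fun s => funext fun w => hins k g hg s w
  refine lp.ext (funext fun w => ?_)
  show (⇑(famOf (P.insA g k t) - famOf (P.insA g k t'))) w = (⇑(famOf (P.insA g k (t - t')) - famOf (P.insA g k 0))) w
  simp only [lp.coeFn_sub, Pi.sub_apply, hfun, famOf_insLinC_apply]
  exact insLinC_affine_pointwise hadd hhom out g k t t' w

/-- [folklore] **`InsHomog` OF THE FAMILY MODEL ON THE TWO-ROW CHART — EXACT, ON ALL TABLES.** -/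
theorem insHomog_of_insLinC
    (hins : ∀ k, ∀ g ∈ W, ∀ (t : C.Dom × (𝒰 × Fin 2) → ℝ) (w : 𝒰 × Fin 2),
      P.insA g k t w = insLinOfChannelC hadd hhom out g k t w) :
    P.toStepModel.InsHomog W := by
  intro k g hg _ a t
  have hfun : ∀ s, P.insA g k s = insLinOfChannelC hadd hhom out g k s := fun s => funext fun w => hins k g hg s w
  refine lp.ext (funext fun w => ?_)
  show (⇑(famOf (P.insA g k (a • t)) - famOf (P.insA g k 0))) w =
    (⇑((a : ℂ) • (famOf (P.insA g k t) - famOf (P.insA g k 0)))) w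
  simp only [lp.coeFn_sub, lp.coeFn_smul, Pi.sub_apply, Pi.smul_apply, hfun, famOf_insLinC_apply]
  exact insLinC_homog_pointwise hadd hhom out g k a t w

/-- [folklore] **`InsBlind` OF THE FAMILY MODEL ON THE TWO-ROW CHART — EXACT** (`ChannelLocal univ T`). -/
theorem insBlind_of_insLinC
    (hins : ∀ k, ∀ g ∈ W, ∀ (t : C.Dom × (𝒰 × Fin 2) → ℝ) (w : 𝒰 × Fin 2),
      P.insA g k t w = insLinOfChannelC hadd hhom out g k t w)
    (hloc : ChannelLocal (Set.univ : Set (𝒰 × Fin 2 → C.Dom → ℝ)) T) : P.toStepModel.InsBlind W := by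
  intro k g hg _ t t' h
  show famOf (P.insA g k t) = famOf (P.insA g k t')
  have : P.insA g k t = P.insA g k t' := funext fun w => by
    rw [hins k g hg t w, hins k g hg t' w]
    exact insLinC_eq_of_agree hadd hhom out hloc g k (fun Y hY w => h (Y, w) hY) w
  rw [this]

/-- [folklore] **THE PER-POINT MI-3a BINDER, Nat form** (gain `√2·c`), for slots reading the complex linear-extension insertion. -/
theorem insertionDampedNat_pointwise_of_insLinC {κ c ω : ℝ} {wt : ℕ → ι → ℝ} {τ : ℕ → ℕ → ℝ}
    (hins : ∀ k, ∀ g ∈ W, ∀ (t : C.Dom × (𝒰 × Fin 2) → ℝ) (w : 𝒰 × Fin 2),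
      P.insA g k t w = insLinOfChannelC hadd hhom out g k t w)
    (hsum : ChannelStepSum (Set.univ : Set (𝒰 × Fin 2 → C.Dom → ℝ)) T)
    (hsize : ChannelSizeAtStepNN (Set.univ : Set (𝒰 × Fin 2 → C.Dom → ℝ)) T κ wt τ) (hwt0 : ∀ k w i, 0 ≤ wt k (out w i))
    (hwt : ∀ k w i, wt k (out w i) ≤ P.rHist (k + 1) * F.wt i) (hτ : ∀ k j, j ≤ k → τ k j ≤ c * ω ^ (k - j)) (hc : 0 ≤ c)
    (hω : 0 ≤ ω) :
    ∀ k, ∀ g ∈ W, ∀ (t t' : C.Dom × (𝒰 × Fin 2) → ℝ) (D : ℕ → ℝ), (∀ j < k, 0 ≤ D j) →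
      (∀ Y, C.scale Y < k → ∀ w, |t (Y, w) - t' (Y, w)| ≤ D (C.scale Y) * Real.exp (-(κ * C.d Y))) →
        ∀ w, ‖P.insA g k t w - P.insA g k t' w‖ ≤ P.rHist k * (Real.sqrt 2 * c * ∑ j ∈ range k, ω ^ (k - 1 - j) * D j) := by
  intro k g hg t t' D hD hb w
  rw [hins k g hg t w, hins k g hg t' w]
  exact norm_insLinC_sub_le hadd hhom out hsum hsize hwt0 hwt hτ hc hω (fun k => (P.rHist_pos k).le) k g hD hb w

/-- [folklore] **THE SAME IN C0's NORMALISATION** (gain `√2·c∕ω`) = the `hdamp` binder of the owner's Re∕Im END. -/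
theorem insertionDamped_pointwise_of_insLinC {κ c ω : ℝ} {wt : ℕ → ι → ℝ} {τ : ℕ → ℕ → ℝ}
    (hins : ∀ k, ∀ g ∈ W, ∀ (t : C.Dom × (𝒰 × Fin 2) → ℝ) (w : 𝒰 × Fin 2),
      P.insA g k t w = insLinOfChannelC hadd hhom out g k t w)
    (hsum : ChannelStepSum (Set.univ : Set (𝒰 × Fin 2 → C.Dom → ℝ)) T)
    (hsize : ChannelSizeAtStepNN (Set.univ : Set (𝒰 × Fin 2 → C.Dom → ℝ)) T κ wt τ) (hwt0 : ∀ k w i, 0 ≤ wt k (out w i))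
    (hwt : ∀ k w i, wt k (out w i) ≤ P.rHist (k + 1) * F.wt i) (hτ : ∀ k j, j ≤ k → τ k j ≤ c * ω ^ (k - j)) (hc : 0 ≤ c)
    (hω : 0 < ω) :
    ∀ k, ∀ g ∈ W, ∀ (t t' : C.Dom × (𝒰 × Fin 2) → ℝ) (D : ℕ → ℝ), (∀ j < k, 0 ≤ D j) →
      (∀ Y, C.scale Y < k → ∀ w, |t (Y, w) - t' (Y, w)| ≤ D (C.scale Y) * Real.exp (-(κ * C.d Y))) →
        ∀ w, ‖P.insA g k t w - P.insA g k t' w‖ ≤ P.rHist k * (Real.sqrt 2 * c / ω * ∑ j ∈ range k, ω ^ (k - j) * D j) := by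
  intro k g hg t t' D hD hb w
  rw [← mul_sum_age_shift hω.ne' (Real.sqrt 2 * c) D]
  exact insertionDampedNat_pointwise_of_insLinC hadd hhom out P hins hsum hsize hwt0 hwt hτ hc hω.le k g hg t t' D hD hb w

/-- [folklore] **MODEL LEVEL: `InsertionDampedNat` (gain `√2·c`) OF THE FAMILY MODEL** (nonempty chart). -/
theorem insertionDampedNat_of_insLinC [Nonempty 𝒰] {κ c ω : ℝ} {wt : ℕ → ι → ℝ} {τ : ℕ → ℕ → ℝ}
    (hins : ∀ k, ∀ g ∈ W, ∀ (t : C.Dom × (𝒰 × Fin 2) → ℝ) (w : 𝒰 × Fin 2),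
      P.insA g k t w = insLinOfChannelC hadd hhom out g k t w)
    (hsum : ChannelStepSum (Set.univ : Set (𝒰 × Fin 2 → C.Dom → ℝ)) T)
    (hsize : ChannelSizeAtStepNN (Set.univ : Set (𝒰 × Fin 2 → C.Dom → ℝ)) T κ wt τ) (hwt0 : ∀ k w i, 0 ≤ wt k (out w i))
    (hwt : ∀ k w i, wt k (out w i) ≤ P.rHist (k + 1) * F.wt i) (hτ : ∀ k j, j ≤ k → τ k j ≤ c * ω ^ (k - j)) (hc : 0 ≤ c)
    (hω : 0 ≤ ω) : P.toStepModel.InsertionDampedNat W κ (Real.sqrt 2 * c) ω := by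
  intro k g hg _ t t' D hD hb
  exact norm_famOf_sub_famOf_le
    (insertionDampedNat_pointwise_of_insLinC hadd hhom out P hins hsum hsize hwt0 hwt hτ hc hω k g hg t t' D hD
      (fun Y hY w => hb (Y, w) hY))

end InsLinC

/-! ## §2 The structural binders of the owner's rotated model are those of leaf-02's model -/

section Rot

variable {Op Hist' : Type*} [NormedAddCommGroup Op] [NormedSpace ℂ Op] [NormedAddCommGroup Hist'] [NormedSpace ℂ Hist']
  (P : PointwiseSlots C (𝒰 × Fin 2) Op Hist')

/-- [folklore] `InsAffine` of the rotated model IS `InsAffine` of leaf-02's model (same inserted families). -/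
theorem insAffine_rot_iff (W : Set (ℕ → ℝ)) : (toStepModelRot P).InsAffine W ↔ P.toStepModel.InsAffine W := Iff.rfl

/-- [folklore] `InsBlind` of the rotated model IS `InsBlind` of leaf-02's model. -/
theorem insBlind_rot_iff (W : Set (ℕ → ℝ)) : (toStepModelRot P).InsBlind W ↔ P.toStepModel.InsBlind W := Iff.rfl

/-- [folklore] `InsHomog` of the rotated model IS `InsHomog` of leaf-02's model. -/
theorem insHomog_rot_iff (W : Set (ℕ → ℝ)) : (toStepModelRot P).InsHomog W ↔ P.toStepModel.InsHomog W := Iff.rfl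

/-- [folklore] The single-scale term `InsScaleBound` of the rotated model IS that of leaf-02's model (same families, same margins). -/
theorem insScaleBound_rot_iff (W : Set (ℕ → ℝ)) (κ E₁ c ω : ℝ) :
    (toStepModelRot P).InsScaleBound W κ E₁ c ω ↔ P.toStepModel.InsScaleBound W κ E₁ c ω := Iff.rfl

/-- [folklore] `InsertionDampedNat` of the rotated model IS that of leaf-02's model. -/
theorem insertionDampedNat_rot_iff (W : Set (ℕ → ℝ)) (κ c ω : ℝ) :
    (toStepModelRot P).InsertionDampedNat W κ c ω ↔ P.toStepModel.InsertionDampedNat W κ c ω := Iff.rfl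

end Rot

/-! ## §3 ENDs on the complex two-row chart for slots reading the complex linear-extension insertion -/

section End

variable {T : ℕ → (ℕ → ℝ) → (𝒰 × Fin 2 → C.Dom → ℝ) → ι → ℝ} {out : 𝒰 × Fin 2 → F.Idx → ι}
variable {Op : Type*} [NormedAddCommGroup Op] [NormedSpace ℂ Op] (P : PointwiseSlots C (𝒰 × Fin 2) Op (Hist F))

/-- [folklore] **END — THE SAME FOR SLOTS READING THE COMPLEX LINEAR-EXTENSION INSERTION** `insLinOfChannelC hadd hhom out` (§3). -/
theorem ne5_of_pointwiseSlots_reIm_insLinC [Nonempty 𝒰]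
    (hadd : ChannelAdditive (Set.univ : Set (𝒰 × Fin 2 → C.Dom → ℝ)) T)
    (hhom : ChannelHomog (Set.univ : Set (𝒰 × Fin 2 → C.Dom → ℝ)) T) {ℰA ℰB : (ℕ → ℝ) → 𝒰 → C.Dom → ℂ}
    {EA : Functional C C.BgA} {EB : Functional C C.BgB} {W : Set (ℕ → ℝ)} {κ G E₀ δ δ' θ c ω : ℝ} {wt : ℕ → ι → ℝ}
    {τ : ℕ → ℕ → ℝ}
    (hbdA : ∀ g ∈ W, ∀ k, BddAbove (Set.range fun w => ‖P.insA g k (tableA (reImTab (C := C) ℰA) g PUnit.unit) w‖))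
    (hbdB : ∀ g ∈ W, ∀ k, BddAbove (Set.range fun w => ‖P.insB g k (tableB (reImTab (C := C) ℰB) g PUnit.unit) w‖))
    (hrA : ∀ g ∈ W, ∀ (X : C.Dom) (u : 𝒰) (i : Fin 2), ℰA g u X =
      P.Out (C.scale X) (P.opA g (C.scale X) (u, i))
        (P.insA g (C.scale X) (tableA (reImTab (C := C) ℰA) g PUnit.unit) (u, i)) X)
    (hrB : ∀ g ∈ W, ∀ (X : C.Dom) (u : 𝒰) (i : Fin 2), ℰB g u X =
      P.Out (C.scale X) (P.opB g (C.scale X) (u, i))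
        (P.insB g (C.scale X) (tableB (reImTab (C := C) ℰB) g PUnit.unit) (u, i)) X)
    (hbase : ∀ k, ∀ g ∈ W, ∀ w,
      (P.opB g k w, P.insB g k (tableB (reImTab (C := C) ℰB) g PUnit.unit) w) ∈ P.Base k g w)
    (henv : ∀ k, ∀ g ∈ W, ∀ w, ∀ q ∈ P.Base k g w, ∀ X : C.Dom, C.scale X = k →
      DifferentiableOn ℂ (fun z : Op × Hist F => P.Out k z.1 z.2 X) (closedBall q.1 (P.rOp k) ×ˢ closedBall q.2 (P.rHist k)) ∧
        ∀ z ∈ closedBall q.1 (P.rOp k) ×ˢ closedBall q.2 (P.rHist k), ‖P.Out k z.1 z.2 X‖ ≤ G * Real.exp (-(κ * C.d X)))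
    (hdA : ∀ g ∈ W, ∀ (u : 𝒰) (X : C.Dom), ‖ℰA g u X‖ ≤ G * Real.exp (-(κ * C.d X)))
    (hdB : ∀ g ∈ W, ∀ (u : 𝒰) (X : C.Dom), ‖ℰB g u X‖ ≤ E₀ * Real.exp (-(κ * C.d X))) (hE₀ : E₀ ≤ G)
    (hop : ∀ k, ∀ g ∈ W, ∀ w : 𝒰 × Fin 2, ‖P.opA g k w - P.opB g k w‖ ≤ δ * θ ^ k * P.rOp k)
    (hinsRate : ∀ k, ∀ g ∈ W, ∀ (t : C.Dom × (𝒰 × Fin 2) → ℝ), (∀ Y w, |t (Y, w)| ≤ E₀ * Real.exp (-(κ * C.d Y))) →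
      ∀ w, ‖P.insA g k t w - P.insB g k t w‖ ≤ δ' * θ ^ k * P.rHist k)
    (hins : ∀ k, ∀ g ∈ W, ∀ (t : C.Dom × (𝒰 × Fin 2) → ℝ) (w : 𝒰 × Fin 2),
      P.insA g k t w = insLinOfChannelC hadd hhom out g k t w)
    (hsum : ChannelStepSum (Set.univ : Set (𝒰 × Fin 2 → C.Dom → ℝ)) T)
    (hsize : ChannelSizeAtStepNN (Set.univ : Set (𝒰 × Fin 2 → C.Dom → ℝ)) T κ wt τ) (hwt0 : ∀ k w i, 0 ≤ wt k (out w i))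
    (hwt : ∀ k w i, wt k (out w i) ≤ P.rHist (k + 1) * F.wt i) (hτ : ∀ k j, j ≤ k → τ k j ≤ c * ω ^ (k - j))
    (hG : 0 ≤ G) (hδ : 0 ≤ δ + δ') (hc : 0 ≤ c) (hω : 0 < ω) (hsmall : (1 + 4 * G * (Real.sqrt 2 * c / ω)) * ω < θ)
    (ι' : C.BgB → 𝒰) (hιA : ∀ g ∈ W, ∀ (U : C.BgB) (X : C.Dom), EA g (C.transport U) X = (ℰA g (ι' U) X).re)
    (hιB : ∀ g ∈ W, ∀ (U : C.BgB) (X : C.Dom), EB g U X = (ℰB g (ι' U) X).re) :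
    NE5 EA EB W κ θ (4 * G * (δ + δ') * (θ - ω) / (θ - (1 + 4 * G * (Real.sqrt 2 * c / ω)) * ω)) :=
  ne5_of_pointwiseSlots_reIm P hbdA hbdB hrA hrB hbase henv hdA hdB hE₀ hop hinsRate
    (insertionDamped_pointwise_of_insLinC hadd hhom out P hins hsum hsize hwt0 hwt hτ hc hω) hG hδ
    (div_nonneg (mul_nonneg (Real.sqrt_nonneg _) hc) hω.le) hω.le hsmall ι' hιA hιB


/-- [folklore] **E1′ ON ROAD D's COMPLEX CHART FOR THE CHANNEL-READING FAMILY MODEL** — the kernel's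
`StepModel.ne5_at_of_stepModel_fibre_scale_nat` (the END face that CARRIES `InsAffine ∧ InsBlind ∧ InsHomog` + the single-scale term
`InsScaleBound κ E₁ c ω`) applied to the owner's ROTATED model `toStepModelRot P` of leaf-02's per-point slots on the two-row chart whose
run-A insertion IS the complex linear-extension channel insertion: the three structural binders EXACT (§1 through §2), the single-scale
term from MI-3a (gain `√2·c`; reference level `E₁ := 1`, idle) by part 4's generic algebra, representation ∕ admissibility from the
COMPLEX identities at every point, the complex-domain decay bounds of the two term families, W1 ∕ W4 from their per-point forms, the two
FIBRE envelopes DISPLAYED at the rotated model (a consumer obtains them from per-point fibre envelopes of the rotated functional by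
leaf-02's `FamilySlots.opFibreEnvelope_of_pointwise` ∕ `histFibreEnvelope_of_pointwise` at `S := toFamilySlotsRot P`); then the owner's
transfer `ne5_of_ne5_reImTab` along the real section `ι'`.  Conclusion
LITERALLY `T4OutputRate.NE5 EA EB W κ θ′ C₅` over the ORIGINAL carriers with E1′'s constant at the gain `√2·c`. -/
theorem ne5_reIm_of_pointwiseSlots_insLinC_fibre_scale_nat [Nonempty 𝒰]
    (hadd : ChannelAdditive (Set.univ : Set (𝒰 × Fin 2 → C.Dom → ℝ)) T)
    (hhom : ChannelHomog (Set.univ : Set (𝒰 × Fin 2 → C.Dom → ℝ)) T) {ℰA ℰB : (ℕ → ℝ) → 𝒰 → C.Dom → ℂ}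
    {EA : Functional C C.BgA} {EB : Functional C C.BgB} {W : Set (ℕ → ℝ)}
    {κ c ω G EA₀ E₀ δ δ' θ θ' ρ₀ B : ℝ} {k₀ : ℕ} {wt : ℕ → ι → ℝ} {τ : ℕ → ℕ → ℝ}
    (hbdA : ∀ g ∈ W, ∀ k, BddAbove (Set.range fun w => ‖P.insA g k (tableA (reImTab (C := C) ℰA) g PUnit.unit) w‖))
    (hbdB : ∀ g ∈ W, ∀ k, BddAbove (Set.range fun w => ‖P.insB g k (tableB (reImTab (C := C) ℰB) g PUnit.unit) w‖))
    (hrA : ∀ g ∈ W, ∀ (X : C.Dom) (u : 𝒰) (i : Fin 2), ℰA g u X =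
      P.Out (C.scale X) (P.opA g (C.scale X) (u, i))
        (P.insA g (C.scale X) (tableA (reImTab (C := C) ℰA) g PUnit.unit) (u, i)) X)
    (hrB : ∀ g ∈ W, ∀ (X : C.Dom) (u : 𝒰) (i : Fin 2), ℰB g u X =
      P.Out (C.scale X) (P.opB g (C.scale X) (u, i))
        (P.insB g (C.scale X) (tableB (reImTab (C := C) ℰB) g PUnit.unit) (u, i)) X)
    (hbase : ∀ k, ∀ g ∈ W, ∀ w,
      (P.opB g k w, P.insB g k (tableB (reImTab (C := C) ℰB) g PUnit.unit) w) ∈ P.Base k g w)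
    (hopF : (toStepModelRot P).OpFibreEnvelope W κ G) (hhistF : (toStepModelRot P).HistFibreEnvelope W κ G)
    (hdA : ∀ g ∈ W, ∀ (u : 𝒰) (X : C.Dom), ‖ℰA g u X‖ ≤ EA₀ * Real.exp (-(κ * C.d X)))
    (hdB : ∀ g ∈ W, ∀ (u : 𝒰) (X : C.Dom), ‖ℰB g u X‖ ≤ E₀ * Real.exp (-(κ * C.d X)))
    (hop : ∀ k, ∀ g ∈ W, ∀ w : 𝒰 × Fin 2, ‖P.opA g k w - P.opB g k w‖ ≤ δ * θ ^ k * P.rOp k)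
    (hinsRate : ∀ k, ∀ g ∈ W, ∀ (t : C.Dom × (𝒰 × Fin 2) → ℝ), (∀ Y w, |t (Y, w)| ≤ E₀ * Real.exp (-(κ * C.d Y))) →
      ∀ w, ‖P.insA g k t w - P.insB g k t w‖ ≤ δ' * θ ^ k * P.rHist k)
    (hins : ∀ k, ∀ g ∈ W, ∀ (t : C.Dom × (𝒰 × Fin 2) → ℝ) (w : 𝒰 × Fin 2),
      P.insA g k t w = insLinOfChannelC hadd hhom out g k t w)
    (hloc : ChannelLocal (Set.univ : Set (𝒰 × Fin 2 → C.Dom → ℝ)) T)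
    (hsum : ChannelStepSum (Set.univ : Set (𝒰 × Fin 2 → C.Dom → ℝ)) T)
    (hsize : ChannelSizeAtStepNN (Set.univ : Set (𝒰 × Fin 2 → C.Dom → ℝ)) T κ wt τ) (hwt0 : ∀ k w i, 0 ≤ wt k (out w i))
    (hwt : ∀ k w i, wt k (out w i) ≤ P.rHist (k + 1) * F.wt i) (hτ : ∀ k j, j ≤ k → τ k j ≤ c * ω ^ (k - j))
    (hG : 0 ≤ G) (hδ : 0 ≤ δ + δ') (hθ : 0 ≤ θ) (hθθ' : θ ≤ θ') (hθ'1 : θ' ≤ 1) (hc : 0 ≤ c) (hω : 0 < ω)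
    (hρ₀ : ρ₀ < 1) (hnear : (δ + δ') * θ ^ k₀ + Real.sqrt 2 * c * (EA₀ + E₀) / (1 - ω) ≤ ρ₀) (hB : 0 ≤ B)
    (hfirst : ∀ k < k₀, EA₀ + E₀ ≤ B * θ ^ k) (hsmall : ω + G / (1 - ρ₀) * (Real.sqrt 2 * c) < θ')
    (ι' : C.BgB → 𝒰) (hιA : ∀ g ∈ W, ∀ (U : C.BgB) (X : C.Dom), EA g (C.transport U) X = (ℰA g (ι' U) X).re)
    (hιB : ∀ g ∈ W, ∀ (U : C.BgB) (X : C.Dom), EB g U X = (ℰB g (ι' U) X).re) :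
    NE5 EA EB W κ θ'
      ((G / (1 - ρ₀) * (δ + δ') + B) * (θ' - ω) / (θ' - (ω + G / (1 - ρ₀) * (Real.sqrt 2 * c)))) :=
  have hdamp := insertionDampedNat_of_insLinC hadd hhom out P hins hsum hsize hwt0 hwt hτ hc hω.le
  ne5_of_ne5_reImTab ι' hιA hιB
    ((toStepModelRot P).ne5_at_of_stepModel_fibre_scale_nat ((representsA_reIm_of_pointwise P) hbdA hrA)
      ((representsB_reIm_of_pointwise P) hbdB hrB) ((inBase_reIm_of_pointwise P) hbdB hbase) hopF hhistF
      (decayBound_reImTab hdA) (decayBound_reImTab hdB)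
      (((operatorRate_rot_iff P) W δ θ).2 (P.operatorRate_of_pointwise hop))
      (((insertionRate_rot_iff P) W κ E₀ δ' θ).2 (P.insertionRate_of_pointwise hinsRate))
      ((insAffine_rot_iff P W).2 (insAffine_of_insLinC hadd hhom out P hins))
      ((insBlind_rot_iff P W).2 (insBlind_of_insLinC hadd hhom out P hins hloc))
      ((insHomog_rot_iff P W).2 (insHomog_of_insLinC hadd hhom out P hins))
      ((insScaleBound_rot_iff P W κ 1 (Real.sqrt 2 * c) ω).2
        (stepModel_insScaleBound_of_insScaleBoundLevel _ (stepModel_insScaleBoundLevel_of_insertionDampedNat _ hdamp) zero_le_one))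
      one_pos hG hδ hθ hθθ' hθ'1 (mul_nonneg (Real.sqrt_nonneg _) hc) hω hρ₀ hnear hB hfirst hsmall)

end End

end Summit.QuantumFields.BalabanUV.T4Continuum.InsertionChannelFamily

end
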